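import Mathlib
import HarnessLib
import Summits.ResolutionOfSingularities.Statement
import Literature.AlgebraicGeometry.Resolution.DiffIdealSheaf
import Literature.AlgebraicGeometry.Motives.VarietiesDimensionProofs

/-!
# FrobeniusBracketPow — Frobenius bracket powers and the Fedder bound (decomp-res node N44 «FedderCut», phase 1)

Route-independent kernel of the decomp-res lens-6 node FedderCut (critic row 51, CLEARED AS MAP NODE WITH ONE
PROVED LEAF; lens file HOME/decomp-res-lens-6/g8/FedderCut.lean sha256 24f14f731384df7d…, census instrument
T-fedder-bed-0 6b642a67…). Ring level (Mathlib only): the bracket power `J^[q]`, the sharp binomial bound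
`(I ⊔ J)^(a+b+1) ≤ I^(a+1) ⊔ J^(b+1)`, the pigeonhole `J^(|S|(q−1)+1) ≤ J^[q]` for a finset `S` generating
`J`, and the FEDDER BOUND: `z ∈ J`, `2 ≤ p ≤ n`, `|S| ≤ n`, `A ≤ (zⁿ) ⊔ J^(n+1)` force `A^(p−1) ≤ J^[p]`. Scheme
level: the typed predicate `FedderImpureAt I p y` («`(𝓘_y)^(p−1) ⊆ 𝔪_y^[p]` on some affine neighbourhood»),
the bound `spanFinrank 𝔪_y ≤ d` on a regular scheme of dimension `≤ d`, and THE CERTIFICATE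
`fedderImpure_of_hyperplanar`: a point
whose maximal ideal needs `≤ n` generators and at which an ideal sheaf satisfies the typed HYPERPLANAR clause of order
`n ≥ p` is Fedder-impure. For a hypersurface `{f = 0}` at a closed point of a regular variety, `f^(p−1) ∈ 𝔪^[p]` is
exactly the failure of Fedder's F-purity criterion (Fedder1983, Thm 1.12); the scheme-theoretic link to F-purity is by
citation only — every statement below is about ideals. No Theses import: consumed by
`Theorems/MaxContactCutFedderCut.lean` (phase 3) and citable by any route.
-/

namespace Summit.ResolutionOfSingularities.ResolutionOfSingularities.Theorems.FrobeniusBracketPow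

open CategoryTheory AlgebraicGeometry

section Algebra

variable {R : Type*} [CommRing R]

/-- The Frobenius BRACKET POWER `J^[q]`: the ideal generated by the `q`-th powers of the elements of `J`
(characteristic-free rendering; in characteristic `p` with `q = p` it is the expansion of `J` under Frobenius;
Fedder1983, §1). -/
def bracketPow (J : Ideal R) (q : ℕ) : Ideal R := Ideal.span {x | ∃ m ∈ J, x = m ^ q}

/-- `m ∈ J ⟹ m^q ∈ J^[q]`. [folklore] -/
theorem pow_mem_bracketPow {J : Ideal R} {q : ℕ} {m : R} (hm : m ∈ J) : m ^ q ∈ bracketPow J q :=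
  Ideal.subset_span ⟨m, hm, rfl⟩

/-- Bracket powers are monotone in the ideal. [folklore] -/
theorem bracketPow_mono {J K : Ideal R} (h : J ≤ K) (q : ℕ) : bracketPow J q ≤ bracketPow K q := by
  refine Ideal.span_mono ?_
  rintro x ⟨m, hm, rfl⟩
  exact ⟨m, h hm, rfl⟩

/-- `J^[q] ≤ J^q`. [folklore] -/
theorem bracketPow_le_pow (J : Ideal R) (q : ℕ) : bracketPow J q ≤ J ^ q := by
  refine Ideal.span_le.mpr ?_
  rintro x ⟨m, hm, rfl⟩
  exact Ideal.pow_mem_pow hm q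

/-- SHARP binomial bound for ideals: `(I ⊔ J)^(a + b + 1) ≤ I^(a+1) ⊔ J^(b+1)` (Mathlib's
`Ideal.sup_pow_add_le_pow_sup_pow` loses one in the exponent). [folklore] -/
theorem sup_pow_le_pow_sup_pow (I J : Ideal R) (a b : ℕ) :
    (I ⊔ J) ^ (a + b + 1) ≤ I ^ (a + 1) ⊔ J ^ (b + 1) := by
  rw [← Ideal.add_eq_sup, ← Ideal.add_eq_sup, add_pow, Ideal.sum_eq_sup]
  apply Finset.sup_le
  intro i _
  by_cases hi : a + 1 ≤ i
  · exact Ideal.mul_le_right.trans (Ideal.mul_le_right.trans ((Ideal.pow_le_pow_right hi).trans le_sup_left))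
  · refine Ideal.mul_le_right.trans (Ideal.mul_le_left.trans ((Ideal.pow_le_pow_right ?_).trans le_sup_right))
    omega

/-- An absorbing summand: `(A ⊔ B)^(m+1) ≤ A ⊔ B^(m+1)`. [folklore] -/
theorem sup_pow_le_sup_pow (A B : Ideal R) (m : ℕ) : (A ⊔ B) ^ (m + 1) ≤ A ⊔ B ^ (m + 1) := by
  have h := sup_pow_le_pow_sup_pow A B 0 m
  simp only [zero_add, pow_one] at h
  simpa [Nat.add_comm] using h

/-- PIGEONHOLE: `(span S)^(|S|·(q−1)+1) ≤ (x^q : x ∈ S)` for a finset `S` and `q ≥ 1`. [folklore] -/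
theorem pow_le_span_pow_of_span [DecidableEq R] (S : Finset R) (q : ℕ) (hq : 1 ≤ q) :
    (Ideal.span (S : Set R)) ^ (S.card * (q - 1) + 1) ≤ Ideal.span ((fun x => x ^ q) '' (S : Set R)) := by
  induction S using Finset.induction_on with
  | empty => simp
  | @insert a S ha ih =>
    rw [Finset.coe_insert, Ideal.span_insert, Finset.card_insert_of_notMem ha]
    have hexp : (S.card + 1) * (q - 1) + 1 = (q - 1) + S.card * (q - 1) + 1 := by ring
    rw [hexp]
    refine (sup_pow_le_pow_sup_pow _ _ (q - 1) (S.card * (q - 1))).trans ?_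
    have hq' : q - 1 + 1 = q := Nat.sub_add_cancel hq
    rw [hq']
    refine sup_le ?_ ?_
    · rw [Ideal.span_singleton_pow, Ideal.span_le, Set.singleton_subset_iff]
      exact Ideal.subset_span ⟨a, Set.mem_insert _ _, rfl⟩
    · exact ih.trans (Ideal.span_mono (Set.image_mono (Set.subset_insert _ _)))

/-- `J^(|S|·(q−1)+1) ≤ J^[q]` when the finset `S` generates `J`. [folklore] -/
theorem pow_le_bracketPow_of_span [DecidableEq R] {J : Ideal R} (S : Finset R) (hS : Ideal.span (S : Set R) = J)
    (q : ℕ) (hq : 1 ≤ q) : J ^ (S.card * (q - 1) + 1) ≤ bracketPow J q := by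
  rw [← hS]
  refine (pow_le_span_pow_of_span S q hq).trans (Ideal.span_le.mpr ?_)
  rintro x ⟨m, hm, rfl⟩
  exact pow_mem_bracketPow (Ideal.subset_span hm)

/-- **FEDDER BOUND** (the node's ring-level kernel). `J` generated by a finset `S` with `|S| ≤ n`, `z ∈ J`,
`2 ≤ p ≤ n`, and `A ≤ (zⁿ) ⊔ J^(n+1)` (the typed HYPERPLANAR clause at level `i = 0`): then `A^(p−1) ≤ J^[p]`. With
`J = 𝔪_y` (regular local ring of dimension `≤ n`) and `A` the stalk of the pencil ideal at a purely-inseparable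
hyperplanar top point of order `n ≥ p`, every `f ∈ A` has `f^(p−1) ∈ 𝔪^[p]`, i.e. fails Fedder's F-purity criterion
(Fedder1983, Thm 1.12). Proof: absorbing summand, `zⁿ = z^p · z^(n−p)`, and the pigeonhole. [folklore] -/
theorem fedder_bound [DecidableEq R] {J : Ideal R} (S : Finset R) (hS : Ideal.span (S : Set R) = J) {z : R}
    (hz : z ∈ J) {p n : ℕ} (hp : 2 ≤ p) (hpn : p ≤ n) (hSn : S.card ≤ n) {A : Ideal R}
    (hA : A ≤ Ideal.span {z ^ n} ⊔ J ^ (n + 1)) : A ^ (p - 1) ≤ bracketPow J p := by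
  obtain ⟨m, hm⟩ : ∃ m, p - 1 = m + 1 := ⟨p - 2, by omega⟩
  have h1 : A ^ (p - 1) ≤ Ideal.span {z ^ n} ⊔ (J ^ (n + 1)) ^ (p - 1) := by
    rw [hm]
    exact (Ideal.pow_right_mono hA _).trans (sup_pow_le_sup_pow _ _ m)
  refine h1.trans (sup_le ?_ ?_)
  · rw [Ideal.span_le, Set.singleton_subset_iff]
    have : z ^ n = z ^ p * z ^ (n - p) := by rw [← pow_add, Nat.add_sub_cancel' hpn]
    rw [this]
    exact Ideal.mul_mem_right _ _ (pow_mem_bracketPow hz)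
  · rw [← pow_mul]
    refine (Ideal.pow_le_pow_right ?_).trans (pow_le_bracketPow_of_span S hS p (by omega))
    have : S.card * (p - 1) ≤ n * (p - 1) := Nat.mul_le_mul_right _ hSn
    rw [hm] at this ⊢
    nlinarith

end Algebra

/-! ## The base-level predicate and the certificate -/

/-- **Fedder-impurity of an ideal sheaf at a point**: on some affine neighbourhood `U ∋ y`,
`(𝓘(U)·𝒪_{Y,y})^(p−1) ⊆ 𝔪_y^[p]`. For a hypersurface `𝓘 = (f)` at a closed point of a regular `Y` this is exactly
the failure of Fedder's criterion (`{f = 0}` is F-pure at `y` iff `f^(p−1) ∉ 𝔪^[p]`; Fedder1983, Thm 1.12); for a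
pencil `(g₁, g₂)` it says that every member of the pencil fails it. The route items INLINE this text. -/
def FedderImpureAt {Y : Scheme.{0}} (I : Y.IdealSheafData) (p : ℕ) (y : Y) : Prop :=
  ∃ U : Y.affineOpens, ∃ hy : y ∈ (U : Y.Opens), (Ideal.map (Y.presheaf.germ U y hy).hom (I.ideal U)) ^ (p - 1) ≤
    bracketPow (IsLocalRing.maximalIdeal (Y.presheaf.stalk y)) p

/-- The inlined text of the route items is `FedderImpureAt` on the nose. [folklore] -/
theorem fedderImpureAt_iff {Y : Scheme.{0}} (I : Y.IdealSheafData) (p : ℕ) (y : Y) :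
    FedderImpureAt I p y ↔
      (∃ U : Y.affineOpens, ∃ hy : y ∈ (U : Y.Opens),
        (Ideal.map (Y.presheaf.germ U y hy).hom (I.ideal U)) ^ (p - 1) ≤
          Ideal.span {x | ∃ m ∈ IsLocalRing.maximalIdeal (Y.presheaf.stalk y), x = m ^ p}) :=
  Iff.rfl

/-- In a regular scheme of dimension `≤ d`, every maximal ideal `𝔪_y` is generated by `≤ d` elements
(`IsRegularLocalRing.spanFinrank_maximalIdeal` + `dim 𝒪_{Y,y} ≤ dim Y`). [folklore] -/
theorem spanFinrank_maximalIdeal_stalk_le {Y : Scheme.{0}}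
    (hY : Literature.AlgebraicGeometry.Resolution.Scheme.IsRegular Y) {d : ℕ}
    (hd : topologicalKrullDim Y ≤ (d : WithBot ℕ∞)) (y : Y) :
    (IsLocalRing.maximalIdeal (Y.presheaf.stalk y)).spanFinrank ≤ d := by
  haveI := hY y
  have h1 : (((IsLocalRing.maximalIdeal (Y.presheaf.stalk y)).spanFinrank : ℕ∞) : WithBot ℕ∞) =
      ringKrullDim (Y.presheaf.stalk y) := IsRegularLocalRing.spanFinrank_maximalIdeal
  have h2 : ringKrullDim (Y.presheaf.stalk y) ≤ topologicalKrullDim Y := by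
    rw [Literature.AlgebraicGeometry.Motives.Scheme.topologicalKrullDim_eq_iSup_ringKrullDim_stalk]
    exact le_iSup (fun x : Y => ringKrullDim (Y.presheaf.stalk x)) y
  have h3 : (((IsLocalRing.maximalIdeal (Y.presheaf.stalk y)).spanFinrank : ℕ∞) : WithBot ℕ∞) ≤ (d : WithBot ℕ∞) :=
    h1 ▸ h2.trans hd
  exact_mod_cast h3

/-- **THE CERTIFICATE** (any dimension). At a point `y` with Noetherian local ring whose maximal ideal is generated
by `≤ n` elements, if `2 ≤ p ≤ n` and the ideal sheaf `I` satisfies the typed HYPERPLANAR clause of order `n` at `y`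
(only its level `i = 0` is used: `𝓘_y ⊆ (zⁿ) + 𝔪^(n+1)`), then `I` is FEDDER-IMPURE at `y` (inlined form). In words:
every member of a pencil at a purely-inseparable hyperplanar top point of order `n ≥ max(p, embdim)` fails Fedder's
criterion (Fedder1983, Thm 1.12). [folklore] -/
theorem fedderImpure_of_hyperplanar {k : Type} [Field k] {Y : Scheme.{0}} (g : Y ⟶ Spec (.of k))
    (I : Y.IdealSheafData) {p n : ℕ} (hp : 2 ≤ p) (hpn : p ≤ n) {y : Y} [IsNoetherianRing (Y.presheaf.stalk y)]
    (hdim : (IsLocalRing.maximalIdeal (Y.presheaf.stalk y)).spanFinrank ≤ n)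
    (hhyp : ∃ U : Y.affineOpens, ∃ hy : y ∈ (U : Y.Opens), ∃ z : Y.presheaf.obj (Opposite.op (U : Y.Opens)),
      (Y.presheaf.germ U y hy).hom z ∈ IsLocalRing.maximalIdeal (Y.presheaf.stalk y) ∧
      (Y.presheaf.germ U y hy).hom z ∉ IsLocalRing.maximalIdeal (Y.presheaf.stalk y) ^ 2 ∧
      ∀ i : ℕ, i < n → ∀ u ∈ (Literature.AlgebraicGeometry.Resolution.diffIdealSheaf
        (g.appTop.hom.comp (AlgebraicGeometry.Scheme.ΓSpecIso (.of k)).inv.hom) i I).ideal U,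
        (Y.presheaf.germ U y hy).hom u ∈ Ideal.span {(Y.presheaf.germ U y hy).hom z ^ (n - i)} ⊔
          IsLocalRing.maximalIdeal (Y.presheaf.stalk y) ^ (n - i + 1)) :
    ∃ U : Y.affineOpens, ∃ hy : y ∈ (U : Y.Opens),
      (Ideal.map (Y.presheaf.germ U y hy).hom (I.ideal U)) ^ (p - 1) ≤
        Ideal.span {x | ∃ m ∈ IsLocalRing.maximalIdeal (Y.presheaf.stalk y), x = m ^ p} := by
  classical
  obtain ⟨U, hy, z, hz, -, hlev⟩ := hhyp
  obtain ⟨S, hScard, hSspan⟩ := Submodule.FG.exists_span_finset_card_eq_spanFinrank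
    (IsNoetherian.noetherian (IsLocalRing.maximalIdeal (Y.presheaf.stalk y)))
  refine ⟨U, hy, fedder_bound S hSspan hz hp hpn (hScard ▸ hdim) ?_⟩
  rw [Ideal.map_le_iff_le_comap]
  intro u hu
  have hu' : u ∈ (Literature.AlgebraicGeometry.Resolution.diffIdealSheaf
      (g.appTop.hom.comp (AlgebraicGeometry.Scheme.ΓSpecIso (.of k)).inv.hom) 0 I).ideal U :=
    Literature.AlgebraicGeometry.Resolution.le_diffIdealSheaf _ 0 I U hu
  have h0 := hlev 0 (by omega) u hu'
  simpa using h0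

/-- Regular-scheme form of the certificate: on a regular `Y` of dimension `≤ d ≤ n`, a hyperplanar point of order
`n ≥ p` of any ideal sheaf is Fedder-impure — used with `d = 4` for PURE-HIGH₄ and DEEP₄ ⊆ IMPURE₄. [folklore] -/
theorem fedderImpure_of_hyperplanar_of_regular {k : Type} [Field k] {Y : Scheme.{0}} (g : Y ⟶ Spec (.of k))
    (hY : Literature.AlgebraicGeometry.Resolution.Scheme.IsRegular Y) {d : ℕ}
    (hd : topologicalKrullDim Y ≤ (d : WithBot ℕ∞)) (I : Y.IdealSheafData) {p n : ℕ} (hp : 2 ≤ p) (hpn : p ≤ n)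
    (hdn : d ≤ n) {y : Y}
    (hhyp : ∃ U : Y.affineOpens, ∃ hy : y ∈ (U : Y.Opens), ∃ z : Y.presheaf.obj (Opposite.op (U : Y.Opens)),
      (Y.presheaf.germ U y hy).hom z ∈ IsLocalRing.maximalIdeal (Y.presheaf.stalk y) ∧
      (Y.presheaf.germ U y hy).hom z ∉ IsLocalRing.maximalIdeal (Y.presheaf.stalk y) ^ 2 ∧
      ∀ i : ℕ, i < n → ∀ u ∈ (Literature.AlgebraicGeometry.Resolution.diffIdealSheaf
        (g.appTop.hom.comp (AlgebraicGeometry.Scheme.ΓSpecIso (.of k)).inv.hom) i I).ideal U,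
        (Y.presheaf.germ U y hy).hom u ∈ Ideal.span {(Y.presheaf.germ U y hy).hom z ^ (n - i)} ⊔
          IsLocalRing.maximalIdeal (Y.presheaf.stalk y) ^ (n - i + 1)) :
    ∃ U : Y.affineOpens, ∃ hy : y ∈ (U : Y.Opens),
      (Ideal.map (Y.presheaf.germ U y hy).hom (I.ideal U)) ^ (p - 1) ≤
        Ideal.span {x | ∃ m ∈ IsLocalRing.maximalIdeal (Y.presheaf.stalk y), x = m ^ p} := by
  haveI := hY y
  exact fedderImpure_of_hyperplanar g I hp hpn ((spanFinrank_maximalIdeal_stalk_le hY hd y).trans hdn) hhyp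

end Summit.ResolutionOfSingularities.ResolutionOfSingularities.Theorems.FrobeniusBracketPow
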